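import Summits.BirchSwinnertonDyer.Rank1Residual.X11b.KolyvaginShaOrderAtPrimeDischarged
import Literature.NumberTheory.EllipticCurves.GrossLMS1991.HeegnerEulerSystemCongruence
import HarnessLib

/-!
# Kolyvagin's ORDER bound `#Ш(E/K)[p^∞] ≤ p^{2M₀}` at ONE odd surjective prime on (KN_p)
# modulo ONE NAMED published fact — Gross 1991 Prop. 3.7 (2) BY NAME — and the Cassels–Tate inputs
# (the generic-prime X11b ORDER END with the last inline cite-only binder `hγ` RE-POINTED)

Cell `b2b-bsdres`, team x11b3 (N8/O2); seat x11b3-p2 GEN 53 (unit claimed D-0075 → BSD:K2/P4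
«Kolyvagin-in-kernel», ladder rows P4/P5).  Summit-side THEOREM-ONLY file (no definition, no named
fact, no `sorry`); `K : Type`; ONE generic odd prime `p` with `ρ̄_{E,p}` onto.

HONEST FRAMING (cell `b2b-bsdres`, run/shared/lean/b2b/bsd-rank1-residual/, verbatim in every
file): the goal of the cell is to DELETE the COMBINATION-SHAPED residual classes of the
Birch–Swinnerton-Dyer formula for ALL analytic-rank `≤ 1` elliptic curves over `ℚ` — "full BSD
formula for every rank `≤ 1` curve in class `C`" assembled STRICTLY from published theorems — so
that the rank-`≤ 1` remainder becomes exactly the CONSTRUCTION-SHAPED classes, which are TYPED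
(missing-input `Prop`s), NOT attempted.  This is not "finishing BSD".  Nothing here is booked; no
mark / label / count / tier moves.

WHAT THIS FILE DOES (b2b-bsdres REFEREE 2 GEN 192 nit n202, second half; lit GEN 154 P.S.,
HOME/INBOX 2026-08-27T12:26:08Z).  The ORDER END of `X11b/KolyvaginShaOrderAtPrimeDischarged`
(x11b3-p2 GEN 52; ladder P4 form: `Ш(E/K)[p^∞]` finite ∧ `p^{M₀}`-torsion ∧ `# ≤ p^{2M₀}` ∧
`ord_p # ≤ 2M₀` for `p^{M₀} x₀ = y_K ∉ p^{M₀+1} E(K)`) carries EXACTLY ONE inline cite-only binder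
`hγ` (Gross 1991 Prop. 3.7 (2)) next to the displayed Cassels–Tate inputs.  That proposition is now
the NAMED, `[cite:]`-tagged Literature fact `GrossLMS1991.prop37_2_reductionCongruence N W K p`
(lit GEN 154, p530891, §E E622; its `.endBinder` IS `hγ` under Gross's six standing hypotheses, all
of which are the END's own hypotheses `_hE`, `_hD`, `hp`, `hp2`, `_hρ`, `hN`).  THIS FILE re-issues
the END with `hγ` TAKEN BY NAME; every other binder (incl. the Cassels–Tate inputs `e`, `inv`,
`hH3`, `hB`, `hPτ`) and the conclusion VERBATIM; proof = the parent END applied to `hγ.endBinder`.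
The named fact is NOT discharged (lit GEN 154: size XL); its image-free sibling
`prop37_2_frobeniusCongruence` (p534286, §E E659) implies it — ONE debt.  The Cassels–Tate inputs
stay displayed hypotheses exactly as in the parent (ladder P5).  Nothing else claimed; nothing
booked; X11b @ `p` stays OPEN / CONSTRUCTION-SHAPED.

## What is proved

* `KolyvaginDischarged.card_sha_primary_le_at_of_kodairaNeron_of_localDuality_of_prop37` — the
  order bound at `p`, modulo the NAMED fact `prop37_2_reductionCongruence N W K p` + `hN` + (KN_p) +
  the Cassels–Tate inputs.

## References

* [McCallumLMS1991] W. G. McCallum, LMS LNS 153 (1991), §1 Theorem p. 296, Lemma 5.1, Prop. 4.7,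
  Lemma 5.3, Thm. 5.4, Cor. 5.6.
* [GrossLMS1991] B. H. Gross, same volume, Thm. 2.2 (2), §3 Prop. 3.7 (2) (p. 240), Prop. 5.3,
  Prop. 6.2 (1).
* [MilneADT2006] J. S. Milne, *Arithmetic Duality Theorems*, 2nd ed., I §6 Prop. 6.9, Thm. 6.13(a).
* [SilvermanAEC2009] Thm. VII.6.1; [Darmon2004] Thm. 3.6, Thm. 3.7; [Nekovar2007] Prop. 4.9.

presearch: `lean search 'of_localDuality_of_prop37'` → none; parent = the tree END named above;
the fact = `GrossLMS1991/HeegnerEulerSystemCongruence`; nothing minted.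
-/

noncomputable section

namespace Summit.BirchSwinnertonDyer.Rank1Residual.X11b.KolyvaginDischarged

open scoped Classical
open WeierstrassCurve Field NumberField IsDedekindDomain Function
open Literature.NumberTheory.EllipticCurves Literature.NumberTheory.GaloisRepresentations
open Literature.NumberTheory.EllipticCurves.RingClassField
open Literature.NumberTheory.EllipticCurves.ModularForms
open Literature.NumberTheory.DiophantineGeometry Literature.NumberTheory.DiophantineGeometry.TateAlgorithm
open Literature.NumberTheory.GaloisCohomology
open Literature.NumberTheory.GaloisRepresentations.DiscreteGaloisModule (mu MuCarrier)
open Literature.NumberTheory.EllipticCurves.GrossLMS1991 (prop37_2_reductionCongruence)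

-- `LocallyCompactSpace Γ_K` / `CharZero` of completions, as in the tree's Cassels–Tate files.
attribute [local instance] absoluteGaloisGroup_compactSpace charZero_placeCompletion

variable {K : Type} [Field K] [NumberField K] {N : ℕ} {W : WeierstrassCurve ℚ}

/-- **Kolyvagin's order bound at ONE odd surjective prime `p` on the Kodaira–Néron sub-class AT `p`:
`Ш(E/K)[p^∞]` finite ∧ `p^{M₀}`-torsion ∧ `#Ш(E/K)[p^∞] ≤ p^{2M₀}` ∧ `ord_p # ≤ 2M₀` — modulo the
NAMED fact `GrossLMS1991.prop37_2_reductionCongruence N W K p` and the Cassels–Tate inputs, no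
inline cite-only input** — for `p^{M₀} x₀ = y_K ∉ p^{M₀+1}E(K)`, `M₀ ≥ 1`.  The tree END
`card_sha_primary_le_at_of_kodairaNeron_of_localDuality` (`X11b/KolyvaginShaOrderAtPrimeDischarged`)
with its inline binder `hγ` SUPPLIED by `hγ.endBinder` under the END's own hypotheses `_hE`, `_hD`,
`hp`, `hp2`, `_hρ`, `hN`; every other binder (incl. the displayed Cassels–Tate inputs) and the
conclusion VERBATIM.  CONDITIONAL on EXACTLY the named fact {`hγ`} AT `p` (PUBLISHED, NOT
discharged) + `hN` + (KN_p) + the Cassels–Tate inputs; nothing booked; no mark / count / tier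
moves. [cite: McCallumLMS1991, §1 Theorem (Kolyvagin), Cor. 5.6] [cite: GrossLMS1991, Thm. 2.2 (2), §3 Prop. 3.7 (2) (p. 240), Prop. 6.2 (1)]
[cite: MilneADT2006, Ch. I §6, Thm. 6.13(a)] [cite: SilvermanAEC2009, Thm. VII.6.1] -/
theorem card_sha_primary_le_at_of_kodairaNeron_of_localDuality_of_prop37 [NeZero N]
    [W.IsGloballyMinimal] {p : ℕ} (hp : p.Prime) (hp2 : p ≠ 2)
    (hN : ∀ [W.IsElliptic], N = W.conductorNorm ℤ)
    (hKNm : ∀ [W.IsElliptic] (v : HeightOneSpectrum (𝓞 K)),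
      (W.baseChange K).HasMultiplicativeReductionAt v →
        ¬ p ∣ (W.baseChange K).ordMinimalDiscriminant v)
    (hKNa : ∀ [W.IsElliptic] (v : HeightOneSpectrum (𝓞 K)),
      (W.baseChange K).HasAdditiveReductionAt v → p ≠ 3 ∨
        ((W.baseChange K).kodairaSymbolAt v ≠ KodairaSymbol.IV ∧
          (W.baseChange K).kodairaSymbolAt v ≠ KodairaSymbol.IVstar))
    (hγ : prop37_2_reductionCongruence N W K p) :
    ∀ [W.IsElliptic] (_hE : ¬ W.HasCM) (_hK : IsImaginaryQuadratic K)
      (_hD : NumberField.discr K ≠ -3 ∧ NumberField.discr K ≠ -4)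
      (_hH : SatisfiesHeegnerHypothesis N K)
      {P : (W.baseChange K).toAffine.Point} (_hP : IsHeegnerPoint N W K P)
      (_hnt : ¬ IsOfFinAddOrder P) (_hρ : W.HasSurjectiveModNGaloisRep p)
      {M₀ : ℕ} (_hM₀ : 1 ≤ M₀) [NeZero (p ^ M₀)] {c : K ≃ₐ[ℚ] K} (_hc : c ≠ 1) (_hcc : c * c = 1)
      {x₀ : (W.baseChange K).toAffine.Point} (_hx₀ : p ^ M₀ • x₀ = P)
      (_hmax : ∀ Q : (W.baseChange K).toAffine.Point, p ^ (M₀ + 1) • Q ≠ P)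
      (e : geomTorsion (W.baseChange K) ((p ^ M₀ * p ^ M₀ : ℕ) : ℤ) →
        geomTorsion (W.baseChange K) ((p ^ M₀ * p ^ M₀ : ℕ) : ℤ) → AlgebraicClosure K)
      (hμ : ∀ S T, e S T ^ (p ^ M₀ * p ^ M₀) = 1)
      (hadd₁ : ∀ S₁ S₂ T, e (S₁ + S₂) T = e S₁ T * e S₂ T)
      (hadd₂ : ∀ S T₁ T₂, e S (T₁ + T₂) = e S T₁ * e S T₂)
      (hgal : ∀ (σ : absoluteGaloisGroup K) (S T : geomTorsion (W.baseChange K) ((p ^ M₀ * p ^ M₀ : ℕ) : ℤ)),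
        σ • e S T = e (σ • S) (σ • T))
      (halt : ∀ T, e T T = 1) (hnondeg : ∀ T, (∀ S, e S T = 1) → T = 0)
      (inv : LocalInvariants K (p ^ M₀ * p ^ M₀)) (hPT' : inv.SumInvLocalizationEqZero)
      (hinv : ∀ v : HeightOneSpectrum (𝓞 K), Injective (inv (Sum.inr v)))
      (hH3 : ∀ x : galoisCohomology (mu K (p ^ M₀ * p ^ M₀)) 3,
        (∀ v : Place K, galoisCohomology.localization (mu K (p ^ M₀ * p ^ M₀)) v 3 x = 0) → x = 0)
      (hB : Literature.GroupTheory.FiniteAbelian.IsLevelPairing (p ^ M₀)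
        (ctLevelPairing (W.baseChange K) (p ^ M₀) e hμ hadd₁ hadd₂ hgal inv halt hPT' hH3
          (localTerm_finite_support (W := W.baseChange K) (m := p ^ M₀) (e := e) (hμ := hμ)
            (hadd₁ := hadd₁) (hadd₂ := hadd₂) (hgal := hgal) halt inv)))
      (hPτ : ∀ z ∈ selmerGroup (W.baseChange K) ((p ^ M₀ * p ^ M₀ : ℕ) : ℤ),
        ∀ t ∈ selmerGroup (W.baseChange K) ((p ^ M₀ * p ^ M₀ : ℕ) : ℤ),
        ctGeneralFun (W.baseChange K) (p ^ M₀) e hμ hadd₁ hadd₂ hgal inv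
            (torsionH1ToH1 (W.baseChange K) _ (conjAct W c _ z))
            (torsionH1ToH1 (W.baseChange K) _ (conjAct W c _ t)) =
          ctGeneralFun (W.baseChange K) (p ^ M₀) e hμ hadd₁ hadd₂ hgal inv
            (torsionH1ToH1 (W.baseChange K) _ z) (torsionH1ToH1 (W.baseChange K) _ t)),
      Finite (AddCommGroup.primaryComponent (W.baseChange K).sha p) ∧
      (∀ c ∈ AddCommGroup.primaryComponent (W.baseChange K).sha p, p ^ M₀ • c = 0) ∧
      Nat.card (AddCommGroup.primaryComponent (W.baseChange K).sha p) ≤ p ^ (2 * M₀) ∧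
      padicValNat p (Nat.card (AddCommGroup.primaryComponent (W.baseChange K).sha p)) ≤ 2 * M₀ := by
  intro _ hE hK hD hH P hP hnt hρ
  exact card_sha_primary_le_at_of_kodairaNeron_of_localDuality hp hp2 hN hKNm hKNa
    (hγ.endBinder (@fun _ ↦ hE) hD hp hp2 (@fun _ ↦ hρ) hN) hE hK hD hH hP hnt hρ

end Summit.BirchSwinnertonDyer.Rank1Residual.X11b.KolyvaginDischarged

end
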